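import Mathlib
import Literature.AlgebraicGeometry.Resolution.FormalInverseFunction
import Literature.AlgebraicGeometry.Resolution.CobordantArcLemma
import Summits.ResolutionOfSingularities.ResolutionOfSingularities.Theorems.WeightedInvariantLocalWeightedDropTwistedCylinder
import Summits.ResolutionOfSingularities.ResolutionOfSingularities.Theorems.WeightedInvariantLocalWeightedDropGradedSliceTwistedSuccessor

/-!
# `WeightedInvariant.LocalWeightedDrop`: TRANSPORT of origin-fixing twisted triviality — the `Ψ_σ` machinery (R5.9, part 1)

Route `ResolutionOfSingularities/WeightedInvariant`, crux `LocalWeightedDrop` (stmt-ResolutionOfSingularities-8899); card A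
of crux `WeightedConstruction` (stmt-ResolutionOfSingularities-0571).  [OURS · L1 W4.3] — KERNEL LANDING of ideator
res-L1-w43-idea-1's PROVED round-5 (sat′) transport stub (`scratch-Transport.r5.lean`, sha16 c3f5e653f8f1eef0, farm
rc 0 · 0 sorries; recipe res-L1-w43-tri-2 O-v9.2, check res-L1-w43-tri-1 §21 (i)); typed into the tree by res-type-099
with idea-1's proofs VERBATIM (namespace, docstrings and this header only).  Nothing here is a statement of the manuscript
under review on ladder RESOLUTION; AI-produced, weaker than expert review.

THE RECIPE.  For a formal coordinate change `θ` of `k⟦x₁..xₙ⟧` (`θ(0) = 0`, `det lin θ ≠ 0`) and a curve `γ` through the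
origin, put `γ̂ := γ(σ^q)` (`gh`) and `Ψ_σ(x) := θ(x + γ̂) − θ(γ̂)` (`psi`): a `σ`-dependent automorphism of the `x`-space
FIXING THE ORIGIN (`subst_zfam_psi`) with the same `x`-linear part as `θ` (`coeff_single_succ_psi`).  Part 2
(`…TwistedTrivialTransport`) inverts `Θ = (σ, Ψ_σ)` and conjugates: `F ∘ θ` is Fix-trivial along `γ` iff `F` is
Fix-trivial along `θ ∘ γ` (`GradedGame.twistedTrivialAlongFix_subst_iff`).

Conventions (tree predicate `GradedGame.TwistedTrivialAlongFix`, `…TwistedCylinder`): `σ = X 0` and `xⱼ = X j.succ` in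
`k⟦Fin (n+1)⟧`; `zfam` = the family `(σ, 0, …, 0)`, whose substitution is the sketch's `pureSigma` (`…TwistedTrivialXOrder`);
`subst_zero'` is res-type-060's (`…GradedSliceTwistedSuccessor`).
-/

set_option linter.dupNamespace false -- mandated namespace of this single-conjunct summit
set_option autoImplicit false

namespace Summit.ResolutionOfSingularities.ResolutionOfSingularities.Theorems

namespace GradedGame

namespace TwistedTransport

open MvPowerSeries
open Literature.AlgebraicGeometry.Resolution
open Literature.AlgebraicGeometry.Resolution.FormalCoordChange (linMat)

variable {k : Type} [Field k]

variable {n : ℕ}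

/-- The family `(σ, 0, …, 0)`: substituting it keeps exactly the pure-`σ` part (the sketch's `pureSigma`). [OURS · L1 W4.3, idea-1 r5] -/
noncomputable def zfam (n : ℕ) : Fin (n + 1) → MvPowerSeries (Fin (n + 1)) k :=
  fun v => if v = 0 then X 0 else 0

/-- `Θ = (σ, Φ)`: an `x`-family over `k⟦σ, x⟧` extended by the identity on `σ`. [OURS · L1 W4.3, idea-1 r5] -/
noncomputable def theta (Φ : Fin n → MvPowerSeries (Fin (n + 1)) k) : Fin (n + 1) → MvPowerSeries (Fin (n + 1)) k :=
  Fin.cases (X 0) Φ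

/-- `Θ 0 = σ`. [OURS · L1 W4.3] -/
theorem theta_zero (Φ : Fin n → MvPowerSeries (Fin (n + 1)) k) : theta Φ 0 = X 0 := by simp [theta]
/-- `Θ (j+1) = Φ j`. [OURS · L1 W4.3] -/
theorem theta_succ (Φ : Fin n → MvPowerSeries (Fin (n + 1)) k) (j : Fin n) : theta Φ j.succ = Φ j := by
  simp [theta]

/-- `zfam` has no constant terms. [OURS · L1 W4.3] -/
theorem constantCoeff_zfam (v : Fin (n + 1)) : constantCoeff (zfam (k := k) n v) = 0 := by
  unfold zfam; split_ifs <;> simp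
/-- `Θ` has no constant terms when `Φ` has none. [OURS · L1 W4.3] -/
theorem constantCoeff_theta {Φ : Fin n → MvPowerSeries (Fin (n + 1)) k} (hΦ0 : ∀ j, constantCoeff (Φ j) = 0)
    (v : Fin (n + 1)) : constantCoeff (theta Φ v) = 0 := by
  refine Fin.cases ?_ (fun j => ?_) v
  · rw [theta_zero]; exact constantCoeff_X _
  · rw [theta_succ]; exact hΦ0 j

/-- `zfam` is substitutable. [OURS · L1 W4.3] -/
theorem hasSubst_zfam : HasSubst (zfam (k := k) n) := hasSubst_of_constantCoeff_zero constantCoeff_zfam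
/-- `Θ` is substitutable. [OURS · L1 W4.3] -/
theorem hasSubst_theta {Φ : Fin n → MvPowerSeries (Fin (n + 1)) k} (hΦ0 : ∀ j, constantCoeff (Φ j) = 0) :
    HasSubst (theta Φ) := hasSubst_of_constantCoeff_zero (constantCoeff_theta hΦ0)
/-- The family of `x`-variables is substitutable. [OURS · L1 W4.3] -/
theorem hasSubst_Xsucc : HasSubst (fun j : Fin n => (X j.succ : MvPowerSeries (Fin (n + 1)) k)) :=
  hasSubst_of_constantCoeff_zero fun _ => constantCoeff_X _

/-- Degree-one coefficients of a variable. [OURS · L1 W4.3] -/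
theorem coeff_single_X {m : ℕ} (s j : Fin m) :
    coeff (Finsupp.single j 1) (X s : MvPowerSeries (Fin m) k) = if j = s then 1 else 0 := by
  rw [coeff_X]
  by_cases h : j = s
  · subst h; simp
  · rw [if_neg, if_neg h]
    intro hh
    exact h (Finsupp.single_left_injective one_ne_zero hh)

/-- Substituting `zfam` keeps the `σ`-linear coefficient. [OURS · L1 W4.3] -/
theorem coeff_single_zero_subst_zfam (φ : MvPowerSeries (Fin (n + 1)) k) :
    coeff (Finsupp.single 0 1) (subst (zfam n) φ) = coeff (Finsupp.single 0 1) φ := by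
  classical
  rw [CobordantArc.coeff_degree_one_subst (zfam n) constantCoeff_zfam φ _ (by simp [Finsupp.degree_single])]
  rw [Finset.sum_eq_single (0 : Fin (n + 1))]
  · simp [zfam]
  · intro v _ hv
    simp [zfam, hv]
  · intro h; exact absurd (Finset.mem_univ _) h

/-- `σ ↦ σ^q` as a one-member family into `k⟦σ, x⟧`. -/
noncomputable def sig (n q : ℕ) : Fin 1 → MvPowerSeries (Fin (n + 1)) k := fun _ => X 0 ^ q

/-- `γ̂ = γ(σ^q)` -/
noncomputable def gh (q : ℕ) (γ : Fin n → MvPowerSeries (Fin 1) k) : Fin n → MvPowerSeries (Fin (n + 1)) k :=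
  fun i => subst (sig n q) (γ i)

/-- the translation family of the predicate: `x_i ↦ x_i + γ_i(σ^q)`. -/
noncomputable def transl (q : ℕ) (γ : Fin n → MvPowerSeries (Fin 1) k) : Fin n → MvPowerSeries (Fin (n + 1)) k :=
  fun i => X i.succ + gh q γ i

/-- tri-2's `Ψ_σ(x) = θ(x + γ̂) − θ(γ̂)` -/
noncomputable def psi (q : ℕ) (γ : Fin n → MvPowerSeries (Fin 1) k) (θ : Fin n → MvPowerSeries (Fin n) k) :
    Fin n → MvPowerSeries (Fin (n + 1)) k :=
  fun i => subst (transl q γ) (θ i) - subst (gh q γ) (θ i)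

section lemmas
variable {q : ℕ} (hq : 0 < q)
include hq

/-- `σ^q` has no constant term (`0 < q`). [OURS · L1 W4.3] -/
theorem constantCoeff_sig (m : Fin 1) : constantCoeff (sig (k := k) n q m) = 0 := by
  simp [sig, hq.ne']

/-- `σ ↦ σ^q` is substitutable. [OURS · L1 W4.3] -/
theorem hasSubst_sig : HasSubst (sig (k := k) n q) :=
  hasSubst_of_constantCoeff_zero (constantCoeff_sig hq)

/-- `γ̂` has no constant terms. [OURS · L1 W4.3] -/
theorem constantCoeff_gh {γ : Fin n → MvPowerSeries (Fin 1) k} (hγ : ∀ i, constantCoeff (γ i) = 0) (i : Fin n) :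
    constantCoeff (gh q γ i) = 0 :=
  constantCoeff_subst_eq_zero (hasSubst_sig hq) (constantCoeff_sig hq) (hγ i)

/-- `γ̂` is substitutable. [OURS · L1 W4.3] -/
theorem hasSubst_gh {γ : Fin n → MvPowerSeries (Fin 1) k} (hγ : ∀ i, constantCoeff (γ i) = 0) :
    HasSubst (gh (k := k) q γ) :=
  hasSubst_of_constantCoeff_zero (constantCoeff_gh hq hγ)

/-- The translation family has no constant terms. [OURS · L1 W4.3] -/
theorem constantCoeff_transl {γ : Fin n → MvPowerSeries (Fin 1) k} (hγ : ∀ i, constantCoeff (γ i) = 0) (i : Fin n) :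
    constantCoeff (transl q γ i) = 0 := by
  unfold transl; rw [map_add, constantCoeff_X, zero_add]; exact constantCoeff_gh hq hγ i

/-- The translation family is substitutable. [OURS · L1 W4.3] -/
theorem hasSubst_transl {γ : Fin n → MvPowerSeries (Fin 1) k} (hγ : ∀ i, constantCoeff (γ i) = 0) :
    HasSubst (transl (k := k) q γ) :=
  hasSubst_of_constantCoeff_zero (constantCoeff_transl hq hγ)

/-- degree-one `x`-coefficients of `γ̂` vanish -/
theorem coeff_single_succ_gh (γ : Fin n → MvPowerSeries (Fin 1) k) (m j : Fin n) :
    coeff (Finsupp.single j.succ 1) (gh (k := k) q γ m) = 0 := by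
  classical
  unfold gh
  rw [CobordantArc.coeff_degree_one_subst (sig n q) (constantCoeff_sig hq) (γ m) _
    (by simp [Finsupp.degree_single])]
  refine Finset.sum_eq_zero fun l _ => ?_
  have : coeff (Finsupp.single j.succ 1) (sig (k := k) n q l) = 0 := by
    simp only [sig, coeff_X_pow]
    rw [if_neg]
    intro h
    have h1 := congrArg (fun d => d j.succ) h
    simp [Fin.succ_ne_zero] at h1
  rw [this, mul_zero]

/-- `Z` fixes `γ̂` -/
theorem subst_zfam_gh (γ : Fin n → MvPowerSeries (Fin 1) k) (m : Fin n) :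
    subst (zfam (k := k) n) (gh q γ m) = gh q γ m := by
  unfold gh
  rw [subst_comp_subst_apply (hasSubst_sig hq) hasSubst_zfam]
  congr 1
  funext l
  simp only [sig]
  rw [subst_pow hasSubst_zfam, subst_X hasSubst_zfam]
  simp [zfam]

/-- a substitution `Ω` with `Ω 0 = σ` fixes `γ̂` -/
theorem subst_gh_of_zero (γ : Fin n → MvPowerSeries (Fin 1) k) {Ω : Fin (n + 1) → MvPowerSeries (Fin (n + 1)) k}
    (hΩs : HasSubst Ω) (hΩ0X : Ω 0 = X 0) (m : Fin n) : subst Ω (gh q γ m) = gh q γ m := by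
  unfold gh
  rw [subst_comp_subst_apply (hasSubst_sig hq) hΩs]
  congr 1
  funext l
  simp only [sig]
  rw [subst_pow hΩs, subst_X hΩs, hΩ0X]

/-- `γ̂` of the transported path `θ ∘ γ` -/
theorem gh_transport {γ : Fin n → MvPowerSeries (Fin 1) k} (hγ : ∀ i, constantCoeff (γ i) = 0)
    (θ : Fin n → MvPowerSeries (Fin n) k) (i : Fin n) :
    gh q (fun i => subst γ (θ i)) i = subst (gh q γ) (θ i) := by
  unfold gh
  rw [subst_comp_subst_apply (hasSubst_of_constantCoeff_zero hγ) (hasSubst_sig hq)]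

variable {γ : Fin n → MvPowerSeries (Fin 1) k} (hγ : ∀ i, constantCoeff (γ i) = 0)
  {θ : Fin n → MvPowerSeries (Fin n) k} (hθ0 : ∀ i, constantCoeff (θ i) = 0)
include hγ hθ0

/-- `Ψ` has no constant terms. [OURS · L1 W4.3] -/
theorem constantCoeff_psi (i : Fin n) : constantCoeff (psi q γ θ i) = 0 := by
  unfold psi
  rw [map_sub, constantCoeff_subst_eq_zero (hasSubst_transl hq hγ) (constantCoeff_transl hq hγ) (hθ0 i),
    constantCoeff_subst_eq_zero (hasSubst_gh hq hγ) (constantCoeff_gh hq hγ) (hθ0 i), sub_zero]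

omit hθ0 in
/-- `x ↦ 0` after `θ(x + γ̂)` gives `θ(γ̂)`. [OURS · L1 W4.3] -/
theorem subst_zfam_subst_transl (i : Fin n) :
    subst (zfam (k := k) n) (subst (transl q γ) (θ i)) = subst (gh q γ) (θ i) := by
  rw [subst_comp_subst_apply (hasSubst_transl hq hγ) hasSubst_zfam]
  congr 1
  funext j
  unfold transl
  rw [subst_add hasSubst_zfam, subst_X hasSubst_zfam, subst_zfam_gh hq]
  simp [zfam, Fin.succ_ne_zero]

omit hθ0 in
/-- `x ↦ 0` fixes `θ(γ̂)`. [OURS · L1 W4.3] -/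
theorem subst_zfam_subst_gh (i : Fin n) :
    subst (zfam (k := k) n) (subst (gh q γ) (θ i)) = subst (gh q γ) (θ i) := by
  rw [subst_comp_subst_apply (hasSubst_gh hq hγ) hasSubst_zfam]
  congr 1
  funext j
  exact subst_zfam_gh hq γ j

omit hθ0 in
/-- `Ψ` is origin-fixing -/
theorem subst_zfam_psi (i : Fin n) : subst (zfam (k := k) n) (psi q γ θ i) = 0 := by
  unfold psi
  rw [subst_sub hasSubst_zfam, subst_zfam_subst_transl hq hγ, subst_zfam_subst_gh hq hγ, sub_self]

omit hθ0 in
/-- the `x`-linear part of `Ψ` is that of `θ` -/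
theorem coeff_single_succ_psi (i j : Fin n) : coeff (Finsupp.single j.succ 1) (psi q γ θ i) = linMat θ i j := by
  classical
  unfold psi
  rw [map_sub, CobordantArc.coeff_degree_one_subst (transl q γ) (constantCoeff_transl hq hγ) (θ i) _
      (by simp [Finsupp.degree_single]),
    CobordantArc.coeff_degree_one_subst (gh q γ) (constantCoeff_gh hq hγ) (θ i) _ (by simp [Finsupp.degree_single])]
  have h2 : ∑ m, coeff (Finsupp.single m 1) (θ i) * coeff (Finsupp.single j.succ 1) (gh q γ m) = 0 := by
    refine Finset.sum_eq_zero fun m _ => ?_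
    rw [coeff_single_succ_gh hq, mul_zero]
  rw [h2, sub_zero, Finset.sum_eq_single j]
  · unfold transl
    rw [map_add, coeff_single_succ_gh hq, add_zero, coeff_single_X, if_pos rfl, mul_one]
    rfl
  · intro m _ hm
    unfold transl
    rw [map_add, coeff_single_succ_gh hq, add_zero, coeff_single_X, if_neg, mul_zero]
    exact fun h => hm (Fin.succ_injective _ h).symm
  · intro h; exact absurd (Finset.mem_univ _) h

end lemmas

/-- the substituted-zero family kills constant-coefficient-free series -/
theorem subst_zeroFamily {m l : ℕ} (f : MvPowerSeries (Fin m) k) (hf : constantCoeff f = 0) :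
    subst (fun _ : Fin m => (0 : MvPowerSeries (Fin l) k)) f = 0 := by
  classical
  have h0s : HasSubst (fun _ : Fin m => (0 : MvPowerSeries (Fin l) k)) :=
    hasSubst_of_constantCoeff_zero fun _ => by simp
  ext d
  rw [coeff_subst h0s f d, map_zero]
  have : (fun e : Fin m →₀ ℕ => coeff e f • coeff d (e.prod fun s r => (0 : MvPowerSeries (Fin l) k) ^ r)) =
      fun _ => 0 := by
    funext e
    by_cases he : e = 0
    · subst he
      rw [Finsupp.prod_zero_index, coeff_zero_eq_constantCoeff_apply, hf, zero_smul]
    · obtain ⟨s, hs⟩ : ∃ s, e s ≠ 0 := by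
        by_contra! hcon
        exact he (Finsupp.ext hcon)
      have hprod : (e.prod fun s r => (0 : MvPowerSeries (Fin l) k) ^ r) = 0 := by
        rw [Finsupp.prod]
        exact Finset.prod_eq_zero (Finsupp.mem_support_iff.mpr hs) (zero_pow hs)
      rw [hprod, map_zero, smul_zero]
  rw [this, finsum_zero]

end TwistedTransport

end GradedGame

end Summit.ResolutionOfSingularities.ResolutionOfSingularities.Theorems
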